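import Literature.Probability.Percolation.AdjExitTight
import Literature.Probability.Percolation.AdjSep
import HarnessLib

/-!
# Surgery for the adjacent landing, two sides: two exits of one colour from a cross structure

Topic `Literature/Probability/Percolation`; family `crit-perc` / near-critical percolation on `𝕋`.
A brick of the near-critical arm-separation theorem for four arms in the ADJACENT colour
arrangement (P. Nolin, EJP 13 (2008), Thm. 11, `j = 4`, `σ = BBWW` [arXiv 0711.4948: Thm. 10],
§4.4 Lemma 15 [arXiv Lemma 14] for two arms of one colour behind two DIFFERENT sides `i₁ ≠ i₂` of
`∂Λ_{2M}`): from a cross structure `CrossData` over `rotConfig i₁ ω`, `rotConfig i₂ ω` (the two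
arms read in the two frames, both explorations good) with middle term tips (`MidGuard`), the two
clean routes of `CrossData.exists_two_clean_routes_of_rot` end in the two different structures and
give one EXIT (`TrapExit`) in each frame, with everything the covering lemma consumes
(`OutMidExits4`): routes from the arm starts in the exit regions, tight outside `Λ_{2M}`; kinds
(fence from below: nominal tip = tip; fence from above: nominal tip `3k` lower) with the tips'
crossings and raw protections (`TipProt`, for the row gaps of `AdjExitGaps`); and the two structures
(route and corner box, in actual coordinates) DISJOINT — by Menger for the routes, by `fence_far` for
the fences, and by the cones of the two sides for everything beyond `∂Λ_{2M}`; the provenance of the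
routes (non-fence admissible sites `B𝔅` and fence sites `FF𝔉`) is kept.

* `TipProt` — the tip of an exit is the tip of a crossing of the right kind with its raw protection;
* `CrossData.exit_of_ref₁` — the exit of a route ending in the structure of `D₁`, with its data;
* **`CrossData.exists_exits_of_rot_prov`** — the statement above, with the provenance of the routes;
  `CrossData.exists_exits_of_rot` — without it.

Everything here is proved; no named facts are introduced.

## References

* P. Nolin, Near-critical percolation in two dimensions, *Electron. J. Probab.* 13 (2008), §4.2
  Def. 6–8, §4.4 Lemma 15 (arXiv 0711.4948: Def. 6–8, Lemma 14), σ = BBWW [Nolin2008].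
-/

noncomputable section

open Set

namespace Literature.Probability.Percolation

open LatticeModels
open PairData (term_isCrossing term_eq tip_mem term_open term_norm_le tip_lt_of_lt)

/-- **Protection data of an exit tip**: the nominal tip row is `t` (fence from below) or `t - 3k`
(fence from above), where `t` is the tip row of an open crossing of the trapezoid from below with the
raw protection `TrapRawOK`, resp. of an open crossing from above with `TrapRawOKUp`, at the scale
`k`. [cite: Nolin2008, §4.4 Lemma 15 (arXiv 0711.4948: Lemma 14)] -/
def TipProt (M : ℕ) (up : Bool) (t : ℤ) (k : ℕ) (χ : SiteConfig (Site 2)) : Prop :=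
  ∃ (c : Finset (Site 2)) (z : Site 2), z 1 = t ∧ z ∈ trapO M ∧ (↑c : Set (Site 2)) ⊆ χ ∧
    (up = false → (trapDomain M).IsCrossing c z ∧ TrapRawOK M c z k χ) ∧
    (up = true → (trapDomain M).flip.IsCrossing c z ∧ TrapRawOKUp M c z k χ)

namespace CrossData

variable {M n k₀ K T₁ T₁' T₂ T₂' i₁ i₂ : ℕ} {ω : SiteConfig (Site 2)}
  (X : CrossData M n k₀ K T₁ T₁' T₂ T₂' (rotConfig i₁ ω) (rotConfig i₂ ω))

/-- **The exit of a route ending in the structure of `D₁`**, with its data: start, kind, tip,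
protection, the route read in the frame, its region, tightness, and WHERE its pieces beyond
`∂Λ_{2M}` are (rows of the cone of the side). [cite: Nolin2008, §4.2 Def. 6–8, §4.4 Lemma 15 (arXiv 0711.4948: Def. 6–8, Lemma 14)] -/
theorem exit_of_ref₁ (hi₁ : i₁ < 6) (hφ₁ : ∀ u, X.φ₁ u = triRotIsoPow i₁ u) (hφ₂ : ∀ u, X.φ₂ u = triRotIsoPow i₂ u)
    (e : X.ExitRef) (he : e.side = 0) (q : Fin 2) {S : Set (Site 2)} (hP : PathIn triGraph S (X.φ₁ (X.D₁.a q)) e.m𝔄)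
    (hS : S ⊆ X.B𝔅 ∪ e.F𝔄) :
    ∃ (F : TrapExit M n k₀ K (rotConfig i₁ ω)) (up : Bool) (t : ℤ),
      F.a = X.D₁.a q ∧ X.φ₁ F.m = e.m𝔄 ∧ F.z 1 = (if up then t - 3 * (F.k : ℤ) else t) ∧
      (-(2 * (M : ℤ)) + 8 * F.k < t ∧ t + 8 * F.k < 0) ∧ TipProt M up t F.k (rotConfig i₁ ω) ∧
      PathIn triGraph (X.φ₁.symm '' S) F.a F.m ∧
      X.φ₁.symm '' S ⊆ (triAnnSet n (2 * M) ∪ trapExitZone M F.z F.k) ∩ rotConfig i₁ ω ∧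
      (∀ v ∈ X.φ₁.symm '' S, 2 * (M : ℤ) < triNorm v → ExitTight F.z F.k v) ∧
      (∀ v ∈ e.F𝔄 ∪ triRotIsoPow i₁ '' triStrip (F.z 0 + F.k) (F.z 1 + F.k) F.k F.k, 2 * (M : ℤ) < triNorm v →
        ∃ u, triRotIsoPow i₁ u = v ∧ u 1 ≤ -1 ∧ 1 ≤ u 0 + u 1) := by
  cases e with
  | below₂ u c z hu => exact absurd he (by simp [ExitRef.side])
  | up₂ u d z hu => exact absurd he (by simp [ExitRef.side])
  | below₁ u c z hu =>
    have hP' : PathIn triGraph S (X.φ₁ (X.D₁.a q)) (X.φ₁ (X.D₁.fence hu).m) := hP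
    have hS' : S ⊆ X.B𝔅 ∪ X.φ₁ '' (X.D₁.fence hu).F := hS
    set F := X.exitBelow₁ hi₁ hφ₁ hφ₂ hu q hP' hS' with hF
    obtain ⟨hjK, hraw⟩ := X.D₁.jOf_spec hu
    have hmid := X.D₁.tip_mid u c z hu _ hjK
    change -(2 * (M : ℤ)) + 8 * (X.D₁.kOf hu : ℤ) < z 1 ∧ z 1 + 8 * (X.D₁.kOf hu : ℤ) < 0 at hmid
    change TrapRawOK M c z (X.D₁.kOf hu) _ at hraw
    have hz := (mem_trapO.1 (tip_mem hu)).2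
    refine ⟨F, false, z 1, rfl, rfl, by simp [hF], hmid, ⟨c, z, rfl, tip_mem hu, term_open hu, fun _ => ⟨term_isCrossing hu, hraw⟩,
      fun h => absurd h (by decide)⟩, ?_, ?_, X.exitBelow₁_tight hi₁ hφ₁ hφ₂ hu q hP' hS', ?_⟩
    · have h := pathIn_map_iso X.φ₁.symm hP'
      rw [RelIso.symm_apply_apply, RelIso.symm_apply_apply] at h
      exact h
    · rintro v ⟨w, hw, rfl⟩
      rcases hS' hw with hw | ⟨y, hy, hyw⟩
      · have hr := X.symm_mem_region₁ hi₁ hφ₁ hφ₂ hw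
        exact ⟨Or.inl hr.1, hr.2⟩
      · rw [← hyw, RelIso.symm_apply_apply]
        have hF := (X.D₁.fence hu).F_subset hy
        exact ⟨Or.inr (trapFrameZone_subset_trapExitZone hF.1.1.1), fenceSet_subset hF⟩
    · intro v hv hvn
      rcases hv with ⟨y, hy, hyv⟩ | ⟨y, hy, hyv⟩
      · refine ⟨y, by rw [← hyv, hφ₁], ?_⟩
        have hyn : 2 * (M : ℤ) < triNorm y := by rw [← hyv, hφ₁, triNorm_triRotIsoPow] at hvn; exact hvn
        have hF := (X.D₁.fence hu).F_subset hy
        have h1 := mem_fenceSet_outside hF hyn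
        have hb := fenceSet_box hF
        have hk := X.D₁.one_le_kOf hu
        constructor
        · omega
        · -- beyond the side: `2M < |y| ≤ max(y₀, …)` with `y₁ < 0` forces `2M < y₀`
          by_contra h0; push Not at h0
          have : triNorm y ≤ 2 * (M : ℤ) := triNorm_le_iff_lin.2 (by omega)
          omega
      · refine ⟨y, hyv, ?_⟩
        rw [mem_triStrip] at hy
        simp only [hF, exitBelow₁_z, exitBelow₁_k] at hy
        have hk := X.D₁.one_le_kOf hu
        constructor <;> omega
  | up₁ u d z hu =>
    have hP' : PathIn triGraph S (X.φ₁ (X.D₁.a q)) (X.φ₁ (X.D₁.fenceUp hu).m) := hP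
    have hS' : S ⊆ X.B𝔅 ∪ X.φ₁ '' (X.D₁.fenceUp hu).F := hS
    set F := X.exitUp₁ hi₁ hφ₁ hφ₂ hu q hP' hS' with hF
    obtain ⟨hjK, hraw⟩ := X.D₁.jOfUp_spec hu
    have hmid := X.D₁.tip_midUp u d z hu _ hjK
    change -(2 * (M : ℤ)) + 8 * (X.D₁.kOfUp hu : ℤ) < z 1 ∧ z 1 + 8 * (X.D₁.kOfUp hu : ℤ) < 0 at hmid
    change TrapRawOKUp M d z (X.D₁.kOfUp hu) _ at hraw
    have hzO : z ∈ trapO M := tip_mem_trapO (PairDataB.termUp_isCrossing hu)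
    have hz := (mem_trapO.1 hzO).2
    refine ⟨F, true, z 1, rfl, rfl, by simp [hF, zUp_one], hmid,
      ⟨d, z, rfl, hzO, PairDataB.termUp_open hu, fun h => absurd h (by decide),
        fun _ => ⟨PairDataB.termUp_isCrossing' hu, hraw⟩⟩, ?_, ?_, X.exitUp₁_tight hi₁ hφ₁ hφ₂ hu q hP' hS', ?_⟩
    · have h := pathIn_map_iso X.φ₁.symm hP'
      rw [RelIso.symm_apply_apply, RelIso.symm_apply_apply] at h
      exact h
    · rintro v ⟨w, hw, rfl⟩
      rcases hS' hw with hw | ⟨y, hy, hyw⟩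
      · have hr := X.symm_mem_region₁ hi₁ hφ₁ hφ₂ hw
        exact ⟨Or.inl hr.1, hr.2⟩
      · rw [← hyw, RelIso.symm_apply_apply]
        have hF := (X.D₁.fenceUp hu).F_subset hy
        exact ⟨Or.inr (trapFrameZoneBelow_subset_trapExitZone hF.1.1.1), fenceSetUp_subset hF⟩
    · intro v hv hvn
      rcases hv with ⟨y, hy, hyv⟩ | ⟨y, hy, hyv⟩
      · refine ⟨y, by rw [← hyv, hφ₁], ?_⟩
        have hyn : 2 * (M : ℤ) < triNorm y := by rw [← hyv, hφ₁, triNorm_triRotIsoPow] at hvn; exact hvn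
        have hF := (X.D₁.fenceUp hu).F_subset hy
        have h1 := mem_fenceSetUp_outside hF hyn
        have hb := fenceSetUp_box hF
        have hk := X.D₁.one_le_kOfUp hu
        constructor
        · omega
        · by_contra h0; push Not at h0
          have : triNorm y ≤ 2 * (M : ℤ) := triNorm_le_iff_lin.2 (by omega)
          omega
      · refine ⟨y, hyv, ?_⟩
        rw [mem_triStrip] at hy
        simp only [hF, exitUp₁_z, exitUp₁_k, zUp_zero, zUp_one] at hy
        have hk := X.D₁.one_le_kOfUp hu
        constructor <;> omega

/-- Corner boxes lie beyond the side. [folklore] -/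
theorem corner_norm_lt {i : ℕ} {z : Site 2} (hz : z 0 = 2 * (M : ℤ)) {k : ℕ} (hk : 1 ≤ k) {v : Site 2}
    (hv : v ∈ triRotIsoPow i '' triStrip (z 0 + k) (z 1 + k) k k) : 2 * (M : ℤ) < triNorm v := by
  obtain ⟨u, hu, rfl⟩ := hv
  rw [mem_triStrip] at hu
  rw [triNorm_triRotIsoPow]
  have h0 : 2 * (M : ℤ) < u 0 := by omega
  exact lt_of_lt_of_le h0 (le_triNorm_iff_lin.2 (Or.inl le_rfl))

/-- **Swapping an exit reference** to the swapped cross structure. [folklore] -/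
def ExitRef.toSwap : X.ExitRef → X.swap.ExitRef
  | .below₁ u c z hu => .below₂ u c z hu
  | .up₁ u d z hu => .up₂ u d z hu
  | .below₂ u c z hu => .below₁ u c z hu
  | .up₂ u d z hu => .up₁ u d z hu

/-- Swapping flips the side. [folklore] -/
theorem ExitRef.toSwap_side (e : X.ExitRef) : (ExitRef.toSwap X e).side = 1 - e.side := by
  cases e <;> rfl

/-- Swapping keeps the actual connection. [folklore] -/
theorem ExitRef.toSwap_F𝔄 (e : X.ExitRef) : (ExitRef.toSwap X e).F𝔄 = e.F𝔄 := by
  cases e <;> rfl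

/-- Swapping keeps the actual fence site. [folklore] -/
theorem ExitRef.toSwap_m𝔄 (e : X.ExitRef) : (ExitRef.toSwap X e).m𝔄 = e.m𝔄 := by
  cases e <;> rfl

/-- A route site beyond `∂Λ_{2M}` is a fence site. [folklore] -/
theorem route_far_mem (hφ₁ : ∀ u, X.φ₁ u = triRotIsoPow i₁ u) (hφ₂ : ∀ u, X.φ₂ u = triRotIsoPow i₂ u)
    {e : X.ExitRef} {S : Set (Site 2)} (hS : S ⊆ X.B𝔅 ∪ e.F𝔄) {v : Site 2} (hv : v ∈ S) (hvn : 2 * (M : ℤ) < triNorm v) : v ∈ e.F𝔄 := by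
  rcases hS hv with h | h
  · exact absurd (X.B𝔅_norm_le hφ₁ hφ₂ h) (not_le.2 hvn)
  · exact h

/-- **Two exits of one colour behind two different sides**, from a cross structure with middle term
tips: one exit in each frame, routes from the arm starts (the same index `q` in `D₁` and `D₂` names
the two different arms), kinds, tips and protections, regions, tightness, and DISJOINT actual
structures; with the provenance of the routes. [cite: Nolin2008, §4.2 Def. 6–8, §4.4 Lemma 15 (arXiv 0711.4948: Def. 6–8, Lemma 14), σ = BBWW (two arms of one colour, two U-shaped regions)] -/
theorem exists_exits_of_rot_prov (hi₁ : i₁ < 6) (hi₂ : i₂ < 6) (hne : i₁ ≠ i₂)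
    (hφ₁ : ∀ u, X.φ₁ u = triRotIsoPow i₁ u) (hφ₂ : ∀ u, X.φ₂ u = triRotIsoPow i₂ u) (hg₁ : X.D₁.MidGuard) (hg₂ : X.D₂.MidGuard) :
    ∃ (q : Fin 2) (F : TrapExit M n k₀ K (rotConfig i₁ ω)) (F' : TrapExit M n k₀ K (rotConfig i₂ ω)) (S S' : Set (Site 2))
      (up up' : Bool) (t t' : ℤ),
      F.a = X.D₁.a q ∧ F'.a = X.D₂.a q ∧
      F.z 1 = (if up then t - 3 * (F.k : ℤ) else t) ∧ F'.z 1 = (if up' then t' - 3 * (F'.k : ℤ) else t') ∧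
      (-(2 * (M : ℤ)) + 8 * F.k < t ∧ t + 8 * F.k < 0) ∧ (-(2 * (M : ℤ)) + 8 * F'.k < t' ∧ t' + 8 * F'.k < 0) ∧
      TipProt M up t F.k (rotConfig i₁ ω) ∧ TipProt M up' t' F'.k (rotConfig i₂ ω) ∧
      PathIn triGraph S F.a F.m ∧ PathIn triGraph S' F'.a F'.m ∧
      S ⊆ (triAnnSet n (2 * M) ∪ trapExitZone M F.z F.k) ∩ rotConfig i₁ ω ∧
      S' ⊆ (triAnnSet n (2 * M) ∪ trapExitZone M F'.z F'.k) ∩ rotConfig i₂ ω ∧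
      (∀ v ∈ S, 2 * (M : ℤ) < triNorm v → ExitTight F.z F.k v) ∧ (∀ v ∈ S', 2 * (M : ℤ) < triNorm v → ExitTight F'.z F'.k v) ∧
      Disjoint (triRotIsoPow i₁ '' (S ∪ triStrip (F.z 0 + F.k) (F.z 1 + F.k) F.k F.k))
        (triRotIsoPow i₂ '' (S' ∪ triStrip (F'.z 0 + F'.k) (F'.z 1 + F'.k) F'.k F'.k)) ∧
      triRotIsoPow i₁ '' S ⊆ X.B𝔅 ∪ X.FF𝔉 ∧ triRotIsoPow i₂ '' S' ⊆ X.B𝔅 ∪ X.FF𝔉 := by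
  obtain ⟨e₀, e₁, S₀, S₁, hside, hP₀, hP₁, -, -, hS₀, hS₁, hdj⟩ := X.exists_two_clean_routes_of_rot hi₁ hi₂ hne hφ₁ hφ₂ hg₁ hg₂
  have hprov : ∀ (e : X.ExitRef) (T : Set (Site 2)), T ⊆ X.B𝔅 ∪ e.F𝔄 → T ⊆ X.B𝔅 ∪ X.FF𝔉 := fun e T hT v hv =>
    (hT hv).imp_right fun h => e.F𝔄_subset_FF h
  -- facts of the swapped structure
  have hφ₁' : ∀ u, X.swap.φ₁ u = triRotIsoPow i₂ u := hφ₂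
  have hφ₂' : ∀ u, X.swap.φ₂ u = triRotIsoPow i₁ u := hφ₁
  have hsides : ∀ e : X.ExitRef, e.side = 0 ∨ e.side = 1 := fun e => by rcases e with _ | _ | _ | _ <;> simp [ExitRef.side]
  -- images of preimages
  have himg : ∀ T : Set (Site 2), triRotIsoPow i₁ '' (X.φ₁.symm '' T) = T := fun T => by
    ext v; constructor
    · rintro ⟨u, ⟨w, hw, rfl⟩, rfl⟩; rw [← hφ₁, RelIso.apply_symm_apply]; exact hw
    · intro hv; exact ⟨X.φ₁.symm v, ⟨v, hv, rfl⟩, by rw [← hφ₁, RelIso.apply_symm_apply]⟩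
  have himg' : ∀ T : Set (Site 2), triRotIsoPow i₂ '' (X.swap.φ₁.symm '' T) = T := fun T => by
    ext v; constructor
    · rintro ⟨u, ⟨w, hw, rfl⟩, rfl⟩; rw [← hφ₁', RelIso.apply_symm_apply]; exact hw
    · intro hv; exact ⟨X.swap.φ₁.symm v, ⟨v, hv, rfl⟩, by rw [← hφ₁', RelIso.apply_symm_apply]⟩
  -- the generic disjointness from the cones
  have cones : ∀ {A B : Set (Site 2)},
      (∀ v ∈ A, 2 * (M : ℤ) < triNorm v → ∃ u, triRotIsoPow i₁ u = v ∧ u 1 ≤ -1 ∧ 1 ≤ u 0 + u 1) →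
      (∀ v ∈ B, 2 * (M : ℤ) < triNorm v → ∃ u, triRotIsoPow i₂ u = v ∧ u 1 ≤ -1 ∧ 1 ≤ u 0 + u 1) →
      ∀ v ∈ A, v ∈ B → 2 * (M : ℤ) < triNorm v → False := by
    intro A B hA hB v hvA hvB hvn
    obtain ⟨u, huv, hu⟩ := hA v hvA hvn
    obtain ⟨u', hu'v, hu'⟩ := hB v hvB hvn
    have h := disjoint_image_rot_of_ne hi₁ hi₂ hne (B := {u}) (B' := {u'}) (fun x hx => by rw [Set.mem_singleton_iff.1 hx]; exact hu)
      (fun x hx => by rw [Set.mem_singleton_iff.1 hx]; exact hu')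
    exact Set.disjoint_left.1 h ⟨u, rfl, huv⟩ ⟨u', rfl, hu'v⟩
  rcases hsides e₀ with h0 | h0
  · -- the route of the arm `0` ends in `D₁`, that of the arm `1` in `D₂`
    have h1 : e₁.side = 1 := by
      rcases hsides e₁ with h | h
      · exact absurd (h0.trans h.symm) hside
      · exact h
    obtain ⟨F, up, t, hFa, hFm, hFz, hmid, hprot, hPF, hSF, htF, hcF⟩ := X.exit_of_ref₁ hi₁ hφ₁ hφ₂ e₀ h0 0 hP₀ hS₀
    have h1' : (ExitRef.toSwap X e₁).side = 0 := by rw [ExitRef.toSwap_side, h1]; decide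
    have hP₁' : PathIn triGraph S₁ (X.swap.φ₁ (X.swap.D₁.a 0)) (ExitRef.toSwap X e₁).m𝔄 := by
      have e1 : X.swap.φ₁ (X.swap.D₁.a 0) = X.φ₁ (X.D₁.a 1) := X.start1.symm
      rw [e1, ExitRef.toSwap_m𝔄]; exact hP₁
    have hS₁' : S₁ ⊆ X.swap.B𝔅 ∪ (ExitRef.toSwap X e₁).F𝔄 := by rw [swap_B𝔅, ExitRef.toSwap_F𝔄]; exact hS₁
    obtain ⟨F', up', t', hFa', hFm', hFz', hmid', hprot', hPF', hSF', htF', hcF'⟩ := X.swap.exit_of_ref₁ hi₂ hφ₁' hφ₂' _ h1' 0 hP₁' hS₁'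
    rw [ExitRef.toSwap_F𝔄] at hcF'
    refine ⟨0, F, F', X.φ₁.symm '' S₀, X.swap.φ₁.symm '' S₁, up, up', t, t', hFa, hFa', hFz, hFz', hmid, hmid', hprot, hprot', hPF, hPF',
      hSF, hSF', htF, htF', ?_, by rw [himg]; exact hprov e₀ S₀ hS₀, by rw [himg']; exact hprov e₁ S₁ hS₁⟩
    rw [Set.image_union, Set.image_union, himg, himg']
    rw [Set.disjoint_left]
    rintro v (hv | hv) (hv' | hv')
    · exact Set.disjoint_left.1 hdj hv hv'
    · have hvn := corner_norm_lt (mem_trapO.1 F'.z_mem).2 (one_le_trapScale (by have := X.D₂.hk₀; omega) _) hv'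
      exact cones hcF hcF' v (Or.inl (X.route_far_mem hφ₁ hφ₂ hS₀ hv hvn)) (Or.inr hv') hvn
    · have hvn := corner_norm_lt (mem_trapO.1 F.z_mem).2 (one_le_trapScale (by have := X.D₁.hk₀; omega) _) hv
      have h := X.swap.route_far_mem hφ₁' hφ₂' hS₁' hv' hvn
      rw [ExitRef.toSwap_F𝔄] at h
      exact cones hcF hcF' v (Or.inr hv) (Or.inl h) hvn
    · have hvn := corner_norm_lt (mem_trapO.1 F.z_mem).2 (one_le_trapScale (by have := X.D₁.hk₀; omega) _) hv
      exact cones hcF hcF' v (Or.inr hv) (Or.inr hv') hvn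
  · -- the route of the arm `0` ends in `D₂`, that of the arm `1` in `D₁`
    have h1 : e₁.side = 0 := by
      rcases hsides e₁ with h | h
      · exact h
      · exact absurd (h0.trans h.symm) hside
    obtain ⟨F, up, t, hFa, hFm, hFz, hmid, hprot, hPF, hSF, htF, hcF⟩ := X.exit_of_ref₁ hi₁ hφ₁ hφ₂ e₁ h1 1 hP₁ hS₁
    have h0' : (ExitRef.toSwap X e₀).side = 0 := by rw [ExitRef.toSwap_side, h0]; decide
    have hP₀' : PathIn triGraph S₀ (X.swap.φ₁ (X.swap.D₁.a 1)) (ExitRef.toSwap X e₀).m𝔄 := by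
      have e1 : X.swap.φ₁ (X.swap.D₁.a 1) = X.φ₁ (X.D₁.a 0) := X.start0.symm
      rw [e1, ExitRef.toSwap_m𝔄]; exact hP₀
    have hS₀' : S₀ ⊆ X.swap.B𝔅 ∪ (ExitRef.toSwap X e₀).F𝔄 := by rw [swap_B𝔅, ExitRef.toSwap_F𝔄]; exact hS₀
    obtain ⟨F', up', t', hFa', hFm', hFz', hmid', hprot', hPF', hSF', htF', hcF'⟩ := X.swap.exit_of_ref₁ hi₂ hφ₁' hφ₂' _ h0' 1 hP₀' hS₀'
    rw [ExitRef.toSwap_F𝔄] at hcF'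
    refine ⟨1, F, F', X.φ₁.symm '' S₁, X.swap.φ₁.symm '' S₀, up, up', t, t', hFa, hFa', hFz, hFz', hmid, hmid', hprot, hprot', hPF, hPF',
      hSF, hSF', htF, htF', ?_, by rw [himg]; exact hprov e₁ S₁ hS₁, by rw [himg']; exact hprov e₀ S₀ hS₀⟩
    rw [Set.image_union, Set.image_union, himg, himg']
    rw [Set.disjoint_left]
    rintro v (hv | hv) (hv' | hv')
    · exact Set.disjoint_left.1 hdj hv' hv
    · have hvn := corner_norm_lt (mem_trapO.1 F'.z_mem).2 (one_le_trapScale (by have := X.D₂.hk₀; omega) _) hv'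
      exact cones hcF hcF' v (Or.inl (X.route_far_mem hφ₁ hφ₂ hS₁ hv hvn)) (Or.inr hv') hvn
    · have hvn := corner_norm_lt (mem_trapO.1 F.z_mem).2 (one_le_trapScale (by have := X.D₁.hk₀; omega) _) hv
      refine cones hcF hcF' v (Or.inr hv) (Or.inl ?_) hvn
      have h := X.swap.route_far_mem hφ₁' hφ₂' hS₀' hv' hvn
      rw [ExitRef.toSwap_F𝔄] at h; exact h
    · have hvn := corner_norm_lt (mem_trapO.1 F.z_mem).2 (one_le_trapScale (by have := X.D₁.hk₀; omega) _) hv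
      exact cones hcF hcF' v (Or.inr hv) (Or.inr hv') hvn

/-- **Two exits of one colour behind two different sides**, from a cross structure with middle term
tips: one exit in each frame, routes from the arm starts (the same index `q` in `D₁` and `D₂` names
the two different arms), kinds, tips and protections, regions, tightness, and DISJOINT actual
structures. [cite: Nolin2008, §4.2 Def. 6–8, §4.4 Lemma 15 (arXiv 0711.4948: Def. 6–8, Lemma 14), σ = BBWW (two arms of one colour, two U-shaped regions)] -/
theorem exists_exits_of_rot (hi₁ : i₁ < 6) (hi₂ : i₂ < 6) (hne : i₁ ≠ i₂)
    (hφ₁ : ∀ u, X.φ₁ u = triRotIsoPow i₁ u) (hφ₂ : ∀ u, X.φ₂ u = triRotIsoPow i₂ u) (hg₁ : X.D₁.MidGuard) (hg₂ : X.D₂.MidGuard) :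
    ∃ (q : Fin 2) (F : TrapExit M n k₀ K (rotConfig i₁ ω)) (F' : TrapExit M n k₀ K (rotConfig i₂ ω)) (S S' : Set (Site 2))
      (up up' : Bool) (t t' : ℤ),
      F.a = X.D₁.a q ∧ F'.a = X.D₂.a q ∧
      F.z 1 = (if up then t - 3 * (F.k : ℤ) else t) ∧ F'.z 1 = (if up' then t' - 3 * (F'.k : ℤ) else t') ∧
      (-(2 * (M : ℤ)) + 8 * F.k < t ∧ t + 8 * F.k < 0) ∧ (-(2 * (M : ℤ)) + 8 * F'.k < t' ∧ t' + 8 * F'.k < 0) ∧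
      TipProt M up t F.k (rotConfig i₁ ω) ∧ TipProt M up' t' F'.k (rotConfig i₂ ω) ∧
      PathIn triGraph S F.a F.m ∧ PathIn triGraph S' F'.a F'.m ∧
      S ⊆ (triAnnSet n (2 * M) ∪ trapExitZone M F.z F.k) ∩ rotConfig i₁ ω ∧
      S' ⊆ (triAnnSet n (2 * M) ∪ trapExitZone M F'.z F'.k) ∩ rotConfig i₂ ω ∧
      (∀ v ∈ S, 2 * (M : ℤ) < triNorm v → ExitTight F.z F.k v) ∧ (∀ v ∈ S', 2 * (M : ℤ) < triNorm v → ExitTight F'.z F'.k v) ∧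
      Disjoint (triRotIsoPow i₁ '' (S ∪ triStrip (F.z 0 + F.k) (F.z 1 + F.k) F.k F.k))
        (triRotIsoPow i₂ '' (S' ∪ triStrip (F'.z 0 + F'.k) (F'.z 1 + F'.k) F'.k F'.k)) := by
  obtain ⟨q, F, F', S, S', up, up', t, t', h1, h2, h3, h4, h5, h6, h7, h8, h9, h10, h11, h12, h13, h14, h15, -, -⟩ :=
    X.exists_exits_of_rot_prov hi₁ hi₂ hne hφ₁ hφ₂ hg₁ hg₂
  exact ⟨q, F, F', S, S', up, up', t, t', h1, h2, h3, h4, h5, h6, h7, h8, h9, h10, h11, h12, h13, h14, h15⟩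

end CrossData

end Literature.Probability.Percolation
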